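import Mathlib
import HarnessLib
import Summits.Ventures.LatticeQCDFlow.Exactness.U1WilsonFlowLOSubstep
import Summits.Ventures.LatticeQCDFlow.Exactness.GaugeFTHMCReversible

/-!
# FT-HMC through the engine's zero-parameter member (masked U(1) Wilson-flow sub-steps) satisfies detailed balance

HONEST FRAMING: exact (Metropolis-corrected) sampling algorithms for lattice gauge theory;
figures of merit are autocorrelation/cost numbers at stated couplings and volumes; no
continuum-physics claim.

Venture `LatticeQCDFlow` (cell pub-lqcd), topic `Exactness`; FANOUT row 14 (`eng-flowhmc`, engine
`latflow.fthmc`, family B; member `maps.u1_wilson_flow_lo`).  NEW WORK of the cell; nothing is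
cited as a fact; no number.  The two corollaries joining `U1WilsonFlowLOSubstep` (the masked
U(1) Wilson-flow Euler sub-step, computed from the full field, is a certified measurable
equivalence of `GaugeConfig d L Circle` with Jacobian `∏_active (1 − εC)`; schedules are lists of
certified layers) with `GaugeFTHMCReversible` (FT-HMC as the engine runs it is REVERSIBLE with
respect to `e^{−S}·⊗Haar` through any certified member): the reported configuration chain of the
leading-order member satisfies detailed balance — the standing hypothesis of the cell's
reversible-chain `τ_int` theorems — for every measurable action, drift coefficient, force,
trajectory length and every step `ε` inside the refusal rule `2(d−1)|ε| < 1`.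

## Content

* **`u1_fthmc_leapfrog_gaussian_isReversible_wilsonFlowLOSubstep`** — one sub-step.
* **`u1_fthmc_leapfrog_gaussian_isReversible_wilsonFlowLO`** — any schedule of sub-steps (the
  engine's: sweep-major, `μ`-major, parity even then odd, `n_sweeps` times), running log-det.

NOT here: ergodicity; SU(N); any number.
-/

noncomputable section

namespace Summit.Ventures.LatticeQCDFlow.Exactness

open Set Function MeasureTheory Summit.Ventures.LatticeQCDFlow.Theory2
open ProbabilityTheory ProbabilityTheory.Kernel
open Literature.MathematicalPhysics.QuantumFieldTheory
open scoped NNReal ENNReal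

variable {d L : ℕ} {X : Type*} [DecidableEq X] (χ : Site d L → X) [NeZero L]

/-- **Detailed balance for FT-HMC through one masked U(1) Wilson-flow sub-step.**  Proper
colouring `χ`, direction `μ`, class `b`, `2(d−1)|ε| < 1`; Gaussian refresh, leapfrog with the link
drift `V_e ← e^{icp_e} V_e` and ANY measurable force, flip, Metropolis on
`(S ∘ F − log ∏_active(1 − εC)) + Σ_e p_e²/2`, forget, report `F V`: for every measurable action
`S` the configuration kernel is `e^{−S} · ⊗_e Haar`-reversible. -/
theorem u1_fthmc_leapfrog_gaussian_isReversible_wilsonFlowLOSubstep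
    (hχ : ∀ (x : Site d L) (i : Fin d), χ (x.shift i) ≠ χ x) (μ : Fin d) (b : X) {ε : ℝ}
    (hε : |ε| * (2 * ((d - 1 : ℕ) : ℝ)) < 1)
    {S : GaugeConfig d L Circle → ℝ} (hS : Measurable S) (c : ℝ)
    {g : GaugeConfig d L Circle → (Edge d L → ℝ)} (hg : Measurable g) (n : ℕ) :
    ∃ F : GaugeConfig d L Circle ≃ᵐ GaugeConfig d L Circle,
      (⇑F = fun (V : GaugeConfig d L Circle) (e : Edge d L) => if e.2 = μ ∧ χ e.1 = b then
          V e * Circle.exp (ε * ∑ ν ∈ Finset.univ.erase e.2,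
            (((plaquetteHolonomy V (e.1 - Pi.single ν 1) e.2 ν : Circle) : ℂ).im -
              ((plaquetteHolonomy V e.1 e.2 ν : Circle) : ℂ).im)) else V e) ∧
      IsReversible
        (conjKernel
          (refreshUpdate
            (involMH
              (⇑((flip : Equiv.Perm (GaugeConfig d L Circle × (Edge d L → ℝ))) *
                  leapfrog (mulDrift fun p : Edge d L → ℝ => fun i => Circle.exp (c * p i)) g ^ n))
              (measurable_flip_leapfrog_pow (measurable_mulDrift (measurable_circleDrift c)) hg n)
              fun z : GaugeConfig d L Circle × (Edge d L → ℝ) =>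
                (S (F z.1) - Real.log (∏ a : {e : Edge d L // e.2 = μ ∧ χ e.1 = b},
          (1 - ε * ∑ ν ∈ Finset.univ.erase a.1.2,
            (((plaquetteHolonomy z.1 a.1.1 a.1.2 ν : Circle) : ℂ).re +
              ((plaquetteHolonomy z.1 (a.1.1 - Pi.single ν 1) a.1.2 ν : Circle) : ℂ).re)))) + ∑ i, z.2 i ^ 2 / 2)
            ((((volume : Measure (Edge d L → ℝ)).withDensity
                  fun p => ENNReal.ofReal (Real.exp (-(∑ i, p i ^ 2 / 2)))) Set.univ)⁻¹ •
              (volume : Measure (Edge d L → ℝ)).withDensity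
                fun p => ENNReal.ofReal (Real.exp (-(∑ i, p i ^ 2 / 2)))))
          F)
        ((Measure.pi fun _ : Edge d L => haarProbability Circle).withDensity
          fun U => ENNReal.ofReal (Real.exp (-S U))) := by
  obtain ⟨F, hF, hJ, hpos, hmeas⟩ := exists_measurableEquiv_u1WilsonFlowLOSubstep χ hχ μ b hε
  exact ⟨F, hF, u1_fthmc_leapfrog_gaussian_isReversible hpos hmeas hJ hS c hg n⟩

/-- **Detailed balance for FT-HMC through the whole leading-order member** (any schedule of
masked U(1) Wilson-flow sub-steps with its running log-det): the reported configuration kernel is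
`e^{−S} · ⊗_e Haar`-reversible. -/
theorem u1_fthmc_leapfrog_gaussian_isReversible_wilsonFlowLO
    (hχ : ∀ (x : Site d L) (i : Fin d), χ (x.shift i) ≠ χ x) {ε : ℝ}
    (hε : |ε| * (2 * ((d - 1 : ℕ) : ℝ)) < 1) (sched : List (Fin d × X))
    {S : GaugeConfig d L Circle → ℝ} (hS : Measurable S) (c : ℝ)
    {g : GaugeConfig d L Circle → (Edge d L → ℝ)} (hg : Measurable g) (n : ℕ) :
    ∃ layers : List ((GaugeConfig d L Circle ≃ᵐ GaugeConfig d L Circle) ×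
        (GaugeConfig d L Circle → ℝ)),
      layers.map (fun Ly => ((Ly.1 : GaugeConfig d L Circle → GaugeConfig d L Circle), Ly.2)) =
        sched.map (fun s =>
        ((fun (V : GaugeConfig d L Circle) (e : Edge d L) => if e.2 = s.1 ∧ χ e.1 = s.2 then
          V e * Circle.exp (ε * ∑ ν ∈ Finset.univ.erase e.2,
            (((plaquetteHolonomy V (e.1 - Pi.single ν 1) e.2 ν : Circle) : ℂ).im -
              ((plaquetteHolonomy V e.1 e.2 ν : Circle) : ℂ).im)) else V e),
         fun V : GaugeConfig d L Circle => ∏ a : {e : Edge d L // e.2 = s.1 ∧ χ e.1 = s.2},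
          (1 - ε * ∑ ν ∈ Finset.univ.erase a.1.2,
            (((plaquetteHolonomy V a.1.1 a.1.2 ν : Circle) : ℂ).re +
              ((plaquetteHolonomy V (a.1.1 - Pi.single ν 1) a.1.2 ν : Circle) : ℂ).re)))) ∧
      IsReversible
        (conjKernel
          (refreshUpdate
            (involMH
              (⇑((flip : Equiv.Perm (GaugeConfig d L Circle × (Edge d L → ℝ))) *
                  leapfrog (mulDrift fun p : Edge d L → ℝ => fun i => Circle.exp (c * p i)) g ^ n))
              (measurable_flip_leapfrog_pow (measurable_mulDrift (measurable_circleDrift c)) hg n)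
              fun z : GaugeConfig d L Circle × (Edge d L → ℝ) =>
                (S (layers.foldr (fun Ly (G : GaugeConfig d L Circle ≃ᵐ GaugeConfig d L Circle) =>
                    Ly.1.trans G) (MeasurableEquiv.refl (GaugeConfig d L Circle)) z.1) -
                  Real.log (layers.foldr (fun Ly K => fun V => Ly.2 V * K (Ly.1 V))
                    (fun _ => (1 : ℝ)) z.1)) +
                  ∑ i, z.2 i ^ 2 / 2)
            ((((volume : Measure (Edge d L → ℝ)).withDensity
                  fun p => ENNReal.ofReal (Real.exp (-(∑ i, p i ^ 2 / 2)))) Set.univ)⁻¹ •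
              (volume : Measure (Edge d L → ℝ)).withDensity
                fun p => ENNReal.ofReal (Real.exp (-(∑ i, p i ^ 2 / 2)))))
          (layers.foldr (fun Ly (G : GaugeConfig d L Circle ≃ᵐ GaugeConfig d L Circle) =>
              Ly.1.trans G) (MeasurableEquiv.refl (GaugeConfig d L Circle))))
        ((Measure.pi fun _ : Edge d L => haarProbability Circle).withDensity
          fun U => ENNReal.ofReal (Real.exp (-S U))) := by
  obtain ⟨layers, hmap, hpos, hmeas, hjac⟩ := exists_layers_u1WilsonFlowLO χ hχ hε sched
  exact ⟨layers, hmap, u1_fthmc_leapfrog_gaussian_isReversible_foldr layers hpos hmeas hjac hS c hg n⟩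

end Summit.Ventures.LatticeQCDFlow.Exactness
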